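import Mathlib
import Literature.MathematicalPhysics.QuantumFieldTheory.Balaban1983to89.B14Eq338Localization

/-!
# `Balaban1983to89.B14Eq339Covariance` — T. Bałaban, *Convergent renormalization expansions for lattice gauge theories*,
# Commun. Math. Phys. **119** (1988) 243–285 [Balaban1988Convergent]: the covariance (3.39) p. 274 of the per-bond terms
# (3.37) and of the per-site terms (3.41) — *"The Euclidean covariance (3.39) follows from the transformation laws (2.29),
# (2.32), and from the definitions of the expressions in (3.37)"* — PROVED as transport of structure for the three pieces
# of the typed (3.37) (`B14.Eq338Localization.E0`) and for (3.41) (`E0site`)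

statement-level skeleton of published theorems with citation tags; proofs where landed; nothing here is a claim about the Yang–Mills mass gap

PDF held: `paper:balaban1988-cmp119-convergent-renormalization` (journal page = PDF page + 242); p. 274 read on the x2 render
`…-p032-x2.png`, p. 260 ((2.29), (2.32)) on `…-p018-x2.png`, p. 275 ((3.41)) on `…-p033-x2.png` of
`run/shared/lean/pub/pub-balaban/b2b-balaban-ref1/pages/1988-cmp119-convergent-renormalization/`.

CITATION HEADER (lean-in-tree rule).  WHAT IS REPRODUCED, verbatim, p. 274 [PDF 32]: *"The terms in (3.38) are gauge
invariant. If they are constructed assuming that Λ_{j+1} is the whole space, i.e. assuming Ω_j = Λ_j = T_η for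
j = 1, …, k+1, then they are also Euclidean covariant, and we have 𝐄^{(k+1)}(rU_{k+1}, r⁻¹b) = 𝐄^{(k+1)}(U_{k+1}, b). (3.39)
Here r is an arbitrary Euclidean transformation of the continuous space T, transforming the lattice T^{(k+1)} into itself.
… The Euclidean covariance (3.39) follows from the transformation laws (2.29), (2.32), and from the definitions of the
expressions in (3.37)."*; p. 275 [PDF 33], after (3.41): *"This function has the same properties as the function (3.37),
namely it is gauge invariant, and, when defined on the whole lattice, it is Euclidean covariant, i.e. it satisfies the
inductive assumption (2.29) for j = k + 1."* — SKELETON rows **B14.Eq3.37–3.39** (clause «(3.39) … NOT proved» of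
ROWS-B14 ≤ v1.16) and **B14.Eq3.41–3.42** (clause «covariance sentence NOT proved»).  TRANSCRIPT NOTE: (3.39) prints
`(rU_{k+1}, r⁻¹b)` where (2.29) p. 260 prints `𝐄^{(j)}(rU_j, rz) = 𝐄^{(j)}(U_j, z)`; the two agree up to the convention for
`rU` (pull-back vs push-forward); the theorems below are stated in the (2.29) form — the transformed data evaluated at the
image bond `σ b` — and give the other form with `σ⁻¹`.

THE TYPED READING (mechanism level; the objects of (3.37) are those of `B14.Eq338Localization`).  A symmetry acts
(i) on the bonds `β = Λ^{(k)}_{k+1}` by a bijection `σ` preserving the bond set `Λ^{(k)*}_{k+1}` (`star`); (ii) on the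
fluctuation-field space by a measurable equivalence `e : Ω ≃ᵐ Ω′`, the Gaussian measure of the transformed background field
being the image measure `ν.map e` (the transformation law of the covariance `C^{(k)}(Λ_{k+1})`, a (2.32)-type input) and
the per-bond factors transforming covariantly, `ψ (σ b) t (e ω) = χ b t ω`; (iii) on the variable index `n` (bond × colour)
of the quadratic form `C*Δ^{(k)}C = T` by an orthogonal matrix `P` mapping the fibre of each bond `b` into the fibre of
`σ b` (signed permutations for lattice symmetries, block rotations for gauge transformations), the operator of the
transformed field being `T′ = P T Pᵀ` (the transformation law of `C`, `Δ^{(k)}`).  PROVED: each of the three pieces of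
(3.37), evaluated on the transformed data at `σ b`, equals the original piece at `b` — the Gaussian bracket
(`gauss337_transport`: conjugation passes through the resolvent product `(T − λ₀)(T + λ)⁻¹` and fibre traces of
`P M Pᵀ` over the fibre of `σ b` are fibre traces of `M` over the fibre of `b`, `fiberTrace_conj`), the characteristic-function
bracket (`chiBracket_transport`: change of variables `MeasureTheory.integral_map_equiv` + re-indexing of `Π_{b′ ≠ b}`),
the expectation bracket (`vBracket_transport`, with the tilted expectation of record `gibbsExpect_transport`), hence (3.39)
for `E0` (`E0_transport`, **`eq339`**) and, by the same bookkeeping, for the per-site (3.41) (`E0site_transport`, for the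
symmetries mapping forward coarse bonds to forward coarse bonds — translations, the rotations fixing the positive
directions; a reflection swaps the two half-bond terms of (3.41), not typed).  Gauge invariance (*"The terms in (3.38) are
gauge invariant"*) is the case `σ = 1` of the same theorems.  Which concrete `e`, `P` realise a given Euclidean `r` on
Bałaban's spaces ((2.29), (2.32) for the ingredients) is the INPUT, not derived here.

Mega-formalization `lit-balaban`, unit `lit-balaban-r11` gen 4 (B14 fold owner), HOME `run/shared/lean/pub/lit-balaban/`.

## References
* [Balaban1988Convergent] T. Bałaban, Commun. Math. Phys. 119 (1988) 243–285, (3.37)–(3.39) p. 274, (3.41) p. 275,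
  (2.29), (2.32) p. 260.
-/

noncomputable section

open _root_.MeasureTheory _root_.Set Finset Matrix
open scoped BigOperators

namespace Literature.MathematicalPhysics.QuantumFieldTheory.Balaban1983to89.B14.Eq339Covariance

open Literature.MathematicalPhysics.QuantumFieldTheory.Balaban1983to89.B14.Eq338Localization
open Literature.MathematicalPhysics.QuantumFieldTheory.Balaban1983to89.B14.InterpolationMeasure

/-! ## §1. The Gaussian bracket of (3.37): conjugation covariance -/

section Gauss

variable {n : Type*} [Fintype n] [DecidableEq n] {β : Type*} [DecidableEq β]

/-- The resolvent product `(T − λ₀I)(T + λI)⁻¹` of the integrand of (3.36)/(3.37) (`T = C*Δ^{(k)}C`).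
[cite: Balaban1988Convergent, (3.37) p.274] -/
def resolventProd (T : Matrix n n ℝ) (lam0 x : ℝ) : Matrix n n ℝ :=
  (T - lam0 • (1 : Matrix n n ℝ)) * (T + x • (1 : Matrix n n ℝ))⁻¹

/-- The bond-diagonal trace `tr( · )(b, b)` of (3.37): the sum of the diagonal entries of `M` over the variable indices
`i` (bond × colour) lying over the bond `b` (`bond i = b`). [cite: Balaban1988Convergent, (3.37) p.274] -/
def fiberTrace (bond : n → β) (M : Matrix n n ℝ) (b : β) : ℝ :=
  ∑ i ∈ univ.filter (fun i => bond i = b), M i i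

/-- The first (Gaussian) bracket of (3.37) at the bond `b`, in the corrected-sign form of the tree
(`B14LogDet336Matrix.sum_fiber_eq337_first`): `−½ log λ₀ · #fibre(b) − ½ ∫₀^∞ dλ (λ₀+λ)⁻¹ tr((T − λ₀I)(T + λI)⁻¹)(b, b)`.
[cite: Balaban1988Convergent, (3.37) p.274] -/
def gauss337 (T : Matrix n n ℝ) (lam0 : ℝ) (bond : n → β) (b : β) : ℝ :=
  -(1 / 2 : ℝ) * Real.log lam0 * #(univ.filter (fun i => bond i = b))
    - (1 / 2 : ℝ) * ∫ x in Ioi (0 : ℝ), (lam0 + x)⁻¹ * fiberTrace bond (resolventProd T lam0 x) b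

/-- Conjugation by an orthogonal `P` passes through the resolvent product:
`((PTPᵀ) − λ₀)((PTPᵀ) + λ)⁻¹ = P (T − λ₀)(T + λ)⁻¹ Pᵀ` — the transformation law of `C*Δ^{(k)}C` ((2.32)-type input)
transported to the integrand of (3.37). [cite: Balaban1988Convergent, (3.39) p.274] -/
theorem resolventProd_conj (T P : Matrix n n ℝ) (hP : Pᵀ * P = 1) (lam0 x : ℝ) :
    resolventProd (P * T * Pᵀ) lam0 x = P * resolventProd T lam0 x * Pᵀ := by
  have hP' : P * Pᵀ = 1 := mul_eq_one_comm.1 hP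
  have h1 : P * T * Pᵀ - lam0 • (1 : Matrix n n ℝ) = P * (T - lam0 • (1 : Matrix n n ℝ)) * Pᵀ := by
    rw [Matrix.mul_sub, Matrix.sub_mul, Matrix.mul_smul, Matrix.smul_mul, Matrix.mul_one, hP']
  have h2 : P * T * Pᵀ + x • (1 : Matrix n n ℝ) = P * (T + x • (1 : Matrix n n ℝ)) * Pᵀ := by
    rw [Matrix.mul_add, Matrix.add_mul, Matrix.mul_smul, Matrix.smul_mul, Matrix.mul_one, hP']
  have hPinv : P⁻¹ = Pᵀ := Matrix.inv_eq_left_inv hP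
  have hPtinv : Pᵀ⁻¹ = P := Matrix.inv_eq_right_inv hP
  unfold resolventProd
  rw [h1, h2, Matrix.mul_inv_rev, Matrix.mul_inv_rev, hPinv, hPtinv]
  calc P * (T - lam0 • (1 : Matrix n n ℝ)) * Pᵀ * (P * ((T + x • (1 : Matrix n n ℝ))⁻¹ * Pᵀ))
      = P * (T - lam0 • (1 : Matrix n n ℝ)) * (Pᵀ * P) * ((T + x • (1 : Matrix n n ℝ))⁻¹ * Pᵀ) := by
        simp only [Matrix.mul_assoc]
    _ = P * ((T - lam0 • (1 : Matrix n n ℝ)) * (T + x • (1 : Matrix n n ℝ))⁻¹) * Pᵀ := by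
        rw [hP, Matrix.mul_one]; simp only [Matrix.mul_assoc]

/-- Fibre traces are invariant under fibre-compatible orthogonal conjugation: if `PᵀP = 1` and `P` maps the variables over
the bond `b` to variables over `σ b` (`P i j ≠ 0 ⇒ bond i = σ (bond j)`), then `tr(P M Pᵀ)(σb, σb) = tr(M)(b, b)`.
[cite: Balaban1988Convergent, (3.39) p.274] -/
theorem fiberTrace_conj (bond : n → β) (σ : β ≃ β) (P : Matrix n n ℝ) (hP : Pᵀ * P = 1)
    (hPblock : ∀ i j, P i j ≠ 0 → bond i = σ (bond j)) (M : Matrix n n ℝ) (b : β) :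
    fiberTrace bond (P * M * Pᵀ) (σ b) = fiberTrace bond M b := by
  have horth : ∀ j l, ∑ i, P i j * P i l = if j = l then 1 else 0 := by
    intro j l
    have := congrFun (congrFun hP j) l
    simpa only [Matrix.mul_apply, Matrix.transpose_apply, Matrix.one_apply] using this
  -- the restricted orthogonality sums
  have hsum : ∀ j l, ∑ i ∈ univ.filter (fun i => bond i = σ b), P i j * P i l
      = if bond j = b then (if j = l then 1 else 0) else 0 := by
    intro j l
    split_ifs with hj hjl
    · subst hjl
      have h0 := horth j j
      rw [if_pos rfl] at h0
      rw [← h0, Finset.sum_filter]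
      refine Finset.sum_congr rfl fun i _ => ?_
      split_ifs with hi
      · rfl
      · have : P i j = 0 := by
          by_contra hne
          exact hi (by rw [hPblock i j hne, hj])
        rw [this, zero_mul]
    · have h0 := horth j l
      rw [if_neg hjl] at h0
      rw [← h0, Finset.sum_filter]
      refine Finset.sum_congr rfl fun i _ => ?_
      split_ifs with hi
      · rfl
      · have : P i j = 0 := by
          by_contra hne
          exact hi (by rw [hPblock i j hne, hj])
        rw [this, zero_mul]
    · refine Finset.sum_eq_zero fun i hi => ?_
      rw [Finset.mem_filter] at hi
      have : P i j = 0 := by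
        by_contra hne
        have h' := hPblock i j hne
        exact hj (σ.injective (by rw [← h', hi.2]))
      rw [this, zero_mul]
  unfold fiberTrace
  calc ∑ i ∈ univ.filter (fun i => bond i = σ b), (P * M * Pᵀ) i i
      = ∑ i ∈ univ.filter (fun i => bond i = σ b), ∑ j, ∑ l, P i j * M j l * P i l := by
        refine Finset.sum_congr rfl fun i _ => ?_
        simp only [Matrix.mul_apply, Matrix.transpose_apply, Finset.sum_mul]
        exact Finset.sum_comm
    _ = ∑ j, ∑ l, M j l * ∑ i ∈ univ.filter (fun i => bond i = σ b), P i j * P i l := by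
        rw [Finset.sum_comm]
        refine Finset.sum_congr rfl fun j _ => ?_
        rw [Finset.sum_comm]
        refine Finset.sum_congr rfl fun l _ => ?_
        rw [Finset.mul_sum]
        exact Finset.sum_congr rfl fun i _ => by ring
    _ = ∑ j, ∑ l, M j l * (if bond j = b then (if j = l then 1 else 0) else 0) := by
        simp_rw [hsum]
    _ = ∑ j ∈ univ.filter (fun j => bond j = b), M j j := by
        rw [Finset.sum_filter]
        refine Finset.sum_congr rfl fun j _ => ?_
        split_ifs with hj
        · simp
        · simp

omit [DecidableEq n] in
/-- The fibre of `σ b` is the `π`-image of the fibre of `b` when the variable permutation `π` covers `σ`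
(`bond (π i) = σ (bond i)`). [cite: Balaban1988Convergent, (3.39) p.274] -/
theorem filter_fiber_eq_map (bond : n → β) (π : n ≃ n) (σ : β ≃ β) (hπ : ∀ i, bond (π i) = σ (bond i)) (b : β) :
    univ.filter (fun i => bond i = σ b) = (univ.filter (fun i => bond i = b)).map π.toEmbedding := by
  ext i
  simp only [Finset.mem_filter, Finset.mem_univ, true_and, Finset.mem_map_equiv]
  have h := hπ (π.symm i)
  rw [Equiv.apply_symm_apply] at h
  constructor
  · intro hi
    exact σ.injective (by rw [← h, hi])
  · intro hi
    rw [h, hi]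

omit [DecidableEq n] in
/-- The fibres of `b` and `σ b` have the same number of variables. [cite: Balaban1988Convergent, (3.39) p.274] -/
theorem card_fiber_eq (bond : n → β) (π : n ≃ n) (σ : β ≃ β) (hπ : ∀ i, bond (π i) = σ (bond i)) (b : β) :
    #(univ.filter (fun i => bond i = σ b)) = #(univ.filter (fun i => bond i = b)) := by
  rw [filter_fiber_eq_map bond π σ hπ b, Finset.card_map]

/-- **Covariance of the Gaussian bracket of (3.37)**: with the operator of the transformed field `T′ = P T Pᵀ`
(`P` orthogonal, fibre-compatible over `σ`, the variable permutation `π` covering `σ`), the first bracket of (3.37) built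
from `T′` at the bond `σ b` equals the one built from `T` at `b`. [cite: Balaban1988Convergent, (3.39) p.274] -/
theorem gauss337_transport (T T' P : Matrix n n ℝ) (hP : Pᵀ * P = 1) (hT : T' = P * T * Pᵀ) (bond : n → β)
    (σ : β ≃ β) (π : n ≃ n) (hπ : ∀ i, bond (π i) = σ (bond i))
    (hPblock : ∀ i j, P i j ≠ 0 → bond i = σ (bond j)) (lam0 : ℝ) (b : β) :
    gauss337 T' lam0 bond (σ b) = gauss337 T lam0 bond b := by
  unfold gauss337
  have hft : ∀ x, fiberTrace bond (resolventProd T' lam0 x) (σ b) = fiberTrace bond (resolventProd T lam0 x) b :=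
    fun x => by rw [hT, resolventProd_conj T P hP, fiberTrace_conj bond σ P hP hPblock]
  simp_rw [hft, card_fiber_eq bond π σ hπ b]

end Gauss

/-! ## §2. The characteristic-function bracket of (3.37): change of variables -/

section Chi

variable {β : Type*} [DecidableEq β] {Ω Ω' : Type*} [MeasurableSpace Ω] [MeasurableSpace Ω']

omit [MeasurableSpace Ω] [MeasurableSpace Ω'] in
/-- Re-indexing `{b′ ∈ Λ* : b′ ≠ σ b} = σ{c ∈ Λ* : c ≠ b}` for a bond bijection `σ` preserving `Λ*`.
[cite: Balaban1988Convergent, (3.39) p.274] -/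
theorem erase_eq_map (σ : β ≃ β) (star : Finset β) (hstar : star.map σ.toEmbedding = star) (b : β) :
    star.erase (σ b) = (star.erase b).map σ.toEmbedding := by
  rw [Finset.map_erase, hstar]
  rfl

omit [MeasurableSpace Ω] [MeasurableSpace Ω'] in
/-- Transport of the product `Π_{b′ ≠ σb} ψ_{b′}(t, eω) = Π_{c ≠ b} χ_c(t, ω)` for covariant per-bond factors
`ψ (σ c) t (e ω) = χ c t ω`. [cite: Balaban1988Convergent, (3.39) p.274] -/
theorem prod_erase_transport (σ : β ≃ β) (star : Finset β) (hstar : star.map σ.toEmbedding = star)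
    {χ : β → ℝ → Ω → ℝ} {ψ : β → ℝ → Ω' → ℝ} (e : Ω → Ω') (hχ : ∀ c t ω, ψ (σ c) t (e ω) = χ c t ω)
    (b : β) (t : ℝ) (ω : Ω) :
    ∏ b' ∈ star.erase (σ b), ψ b' t (e ω) = ∏ c ∈ star.erase b, χ c t ω := by
  rw [erase_eq_map σ star hstar b, Finset.prod_map]
  exact Finset.prod_congr rfl fun c _ => hχ c t ω

omit [DecidableEq β] [MeasurableSpace Ω] [MeasurableSpace Ω'] in
/-- Transport of the full product `χ_t`: `χ′_t(eω) = χ_t(ω)`. [cite: Balaban1988Convergent, (3.39) p.274] -/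
theorem chiProd_transport (σ : β ≃ β) (star : Finset β) (hstar : star.map σ.toEmbedding = star)
    {χ : β → ℝ → Ω → ℝ} {ψ : β → ℝ → Ω' → ℝ} (e : Ω → Ω') (hχ : ∀ c t ω, ψ (σ c) t (e ω) = χ c t ω)
    (t : ℝ) (ω : Ω) :
    chiProd star ψ t (e ω) = chiProd star χ t ω := by
  unfold chiProd
  conv_lhs => rw [← hstar]
  rw [Finset.prod_map]
  exact Finset.prod_congr rfl fun c _ => hχ c t ω

/-- **Covariance of the characteristic-function bracket of (3.37)**: if the Gaussian measure of the transformed field is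
the image measure `ν.map e` of a measurable equivalence `e` of the fluctuation-field spaces and the per-bond factors (and
their `t`-derivatives) transform covariantly over the bond bijection `σ` preserving `Λ*`, then the middle bracket of
(3.37) built from the transformed data at `σ b` equals the original one at `b`. [cite: Balaban1988Convergent, (3.39) p.274] -/
theorem chiBracket_transport (e : Ω ≃ᵐ Ω') (ν : Measure Ω) (σ : β ≃ β) (star : Finset β)
    (hstar : star.map σ.toEmbedding = star) {χ χ' : β → ℝ → Ω → ℝ} {ψ ψ' : β → ℝ → Ω' → ℝ}
    (hχ : ∀ c t ω, ψ (σ c) t (e ω) = χ c t ω) (hχ' : ∀ c t ω, ψ' (σ c) t (e ω) = χ' c t ω) (b : β) :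
    chiBracket (ν.map e) star ψ ψ' (σ b) = chiBracket ν star χ χ' b := by
  unfold chiBracket
  have h1 : ∀ t : ℝ, ∫ ω', (∏ b' ∈ star.erase (σ b), ψ b' t ω') * ψ' (σ b) t ω' ∂(ν.map e)
      = ∫ ω, (∏ c ∈ star.erase b, χ c t ω) * χ' b t ω ∂ν := by
    intro t
    rw [MeasureTheory.integral_map_equiv]
    refine integral_congr_ae (Filter.Eventually.of_forall fun ω => ?_)
    show (∏ b' ∈ star.erase (σ b), ψ b' t (e ω)) * ψ' (σ b) t (e ω) = (∏ c ∈ star.erase b, χ c t ω) * χ' b t ω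
    rw [prod_erase_transport σ star hstar e hχ b t ω, hχ' b t ω]
  have h2 : ∀ t : ℝ, ∫ ω', chiProd star ψ t ω' ∂(ν.map e) = ∫ ω, chiProd star χ t ω ∂ν := by
    intro t
    rw [MeasureTheory.integral_map_equiv]
    exact integral_congr_ae (Filter.Eventually.of_forall fun ω => chiProd_transport σ star hstar e hχ t ω)
  simp_rw [h1, h2]

/-- The invariant-measure form (Euclidean transformations of one and the same fluctuation-field space leaving the
Gaussian measure invariant, `ν.map e = ν`). [cite: Balaban1988Convergent, (3.39) p.274] -/
theorem chiBracket_invariant (e : Ω ≃ᵐ Ω) (ν : Measure Ω) (hν : ν.map e = ν) (σ : β ≃ β) (star : Finset β)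
    (hstar : star.map σ.toEmbedding = star) {χ χ' ψ ψ' : β → ℝ → Ω → ℝ}
    (hχ : ∀ c t ω, ψ (σ c) t (e ω) = χ c t ω) (hχ' : ∀ c t ω, ψ' (σ c) t (e ω) = χ' c t ω) (b : β) :
    chiBracket ν star ψ ψ' (σ b) = chiBracket ν star χ χ' b := by
  have := chiBracket_transport e ν σ star hstar hχ hχ' b
  rwa [hν] at this

end Chi

/-! ## §3. The expectation bracket of (3.37): covariance of `⟨·⟩_t` -/

section V

variable {β : Type*} {Ω Ω' : Type*} [MeasurableSpace Ω] [MeasurableSpace Ω']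

omit [MeasurableSpace Ω] [MeasurableSpace Ω'] in
/-- **Covariance of the last bracket of (3.37)**: if the expectation of the transformed data is the push-forward
(`Ex′ t G = Ex t (G ∘ e)`) and the inserts `f_b = tr 𝐕_k′(tg_k, A, b)(CA)(b)` transform covariantly over `σ`, then
`∫₀¹ dt ⟨f′_{σb}⟩′_t = ∫₀¹ dt ⟨f_b⟩_t`. [cite: Balaban1988Convergent, (3.39) p.274] -/
theorem vBracket_transport {Ex : ℝ → (Ω → ℝ) → ℝ} {Ex' : ℝ → (Ω' → ℝ) → ℝ} (e : Ω → Ω')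
    (hEx : ∀ t (G : Ω' → ℝ), Ex' t G = Ex t (G ∘ e)) (σ : β ≃ β) {f : β → ℝ → Ω → ℝ} {f' : β → ℝ → Ω' → ℝ}
    (hf : ∀ c t ω, f' (σ c) t (e ω) = f c t ω) (b : β) :
    vBracket Ex' f' (σ b) = vBracket Ex f b := by
  unfold vBracket
  have : (fun t => Ex' t (f' (σ b) t)) = fun t => Ex t (f b t) := by
    funext t
    rw [hEx]
    exact congrArg (Ex t) (funext fun ω => hf b t ω)
  rw [this]

/-- The tilted expectation of record `⟨·⟩_t = gibbsExpect ν w S · t` ((3.27)/(3.30)) IS the push-forward expectation of the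
transformed data: for `ν′ = ν.map e`, `w′ ∘ e = w`, `S′_t ∘ e = S_t`,
`gibbsExpect ν′ w′ S′ G t = gibbsExpect ν w S (G ∘ e) t`. [cite: Balaban1988Convergent, (3.39) p.274] -/
theorem gibbsExpect_transport (e : Ω ≃ᵐ Ω') (ν : Measure Ω) {w : Ω → ℝ} {w' : Ω' → ℝ} {S : ℝ → Ω → ℝ}
    {S' : ℝ → Ω' → ℝ} (hw : ∀ ω, w' (e ω) = w ω) (hS : ∀ t ω, S' t (e ω) = S t ω) (G : Ω' → ℝ) (t : ℝ) :
    gibbsExpect (ν.map e) w' S' G t = gibbsExpect ν w S (G ∘ e) t := by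
  unfold gibbsExpect gibbsNum partFn gibbsWeight
  rw [MeasureTheory.integral_map_equiv, MeasureTheory.integral_map_equiv]
  simp only [hw, hS, Function.comp_apply]

end V

/-! ## §4. (3.39) for `𝐄₀^{(k+1)}(Λ_{k+1}, U_{k+1}, b)` and for the per-site terms (3.41) -/

section Assembly

variable {β : Type*} [DecidableEq β]

/-- **(3.39), structure**: if each of the three pieces of (3.37) built from the transformed background field, evaluated at
`σ b`, equals the original piece at `b`, and `σ` preserves `Λ*`, then
`𝐄₀′(σ b) = 𝐄₀(b)` for `E0` of `B14.Eq338Localization`. [cite: Balaban1988Convergent, (3.39) p.274] -/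
theorem E0_transport (σ : β ≃ β) (star : Finset β) (hstar : star.map σ.toEmbedding = star)
    {gaussB chiB vB gaussB' chiB' vB' : β → ℝ} (g : ℝ) (hg : ∀ b, gaussB' (σ b) = gaussB b)
    (hc : ∀ b, chiB' (σ b) = chiB b) (hv : ∀ b, vB' (σ b) = vB b) (b : β) :
    E0 star gaussB' chiB' g vB' (σ b) = E0 star gaussB chiB g vB b := by
  have hmem : σ b ∈ star ↔ b ∈ star := by
    constructor
    · intro h
      rw [← hstar, Finset.mem_map_equiv, Equiv.symm_apply_apply] at h
      exact h
    · intro h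
      rw [← hstar, Finset.mem_map_equiv, Equiv.symm_apply_apply]
      exact h
  unfold E0
  rw [hg, hc, hv]
  by_cases h : b ∈ star
  · rw [if_pos (hmem.2 h), if_pos h]
  · rw [if_neg (fun h' => h (hmem.1 h')), if_neg h]

/-- **(3.39) PROVED at mechanism level** for the fully concrete pieces: the Gaussian bracket `gauss337` with the
conjugated operator `T′ = PTPᵀ`, the characteristic-function bracket `chiBracket` with the image measure `ν.map e`
and covariant factors, the expectation bracket `vBracket` with the push-forward expectation and covariant inserts —
*"The Euclidean covariance (3.39) follows from the transformation laws (2.29), (2.32), and from the definitions of the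
expressions in (3.37)"*: `𝐄₀^{(k+1)}(rU_{k+1}, rb) = 𝐄₀^{(k+1)}(U_{k+1}, b)` in the (2.29) convention (`σ = r` on bonds).
[cite: Balaban1988Convergent, (3.39) p.274] -/
theorem eq339 {n : Type*} [Fintype n] [DecidableEq n] {Ω Ω' : Type*} [MeasurableSpace Ω] [MeasurableSpace Ω']
    (σ : β ≃ β) (star : Finset β) (hstar : star.map σ.toEmbedding = star)
    -- the Gaussian bracket data and its transformation law
    (T T' P : Matrix n n ℝ) (hP : Pᵀ * P = 1) (hT : T' = P * T * Pᵀ) (bond : n → β) (π : n ≃ n)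
    (hπ : ∀ i, bond (π i) = σ (bond i)) (hPblock : ∀ i j, P i j ≠ 0 → bond i = σ (bond j)) (lam0 : ℝ)
    -- the characteristic-function bracket data and its transformation law
    (e : Ω ≃ᵐ Ω') (ν : Measure Ω) {χ χ' : β → ℝ → Ω → ℝ} {ψ ψ' : β → ℝ → Ω' → ℝ}
    (hχ : ∀ c t ω, ψ (σ c) t (e ω) = χ c t ω) (hχ' : ∀ c t ω, ψ' (σ c) t (e ω) = χ' c t ω)
    -- the expectation bracket data and its transformation law
    {Ex : ℝ → (Ω → ℝ) → ℝ} {Ex' : ℝ → (Ω' → ℝ) → ℝ} (hEx : ∀ t (G : Ω' → ℝ), Ex' t G = Ex t (G ∘ e))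
    {f : β → ℝ → Ω → ℝ} {f' : β → ℝ → Ω' → ℝ} (hf : ∀ c t ω, f' (σ c) t (e ω) = f c t ω) (g : ℝ) (b : β) :
    E0 star (gauss337 T' lam0 bond) (chiBracket (ν.map e) star ψ ψ') g (vBracket Ex' f') (σ b)
      = E0 star (gauss337 T lam0 bond) (chiBracket ν star χ χ') g (vBracket Ex f) b :=
  E0_transport σ star hstar g (fun c => gauss337_transport T T' P hP hT bond σ π hπ hPblock lam0 c)
    (fun c => chiBracket_transport e ν σ star hstar hχ hχ' c) (fun c => vBracket_transport e hEx σ hf c) b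

/-- The printed form of (3.39) with `r⁻¹b`: `𝐄₀′(b) = 𝐄₀(σ⁻¹ b)` (same hypotheses as `E0_transport`).
[cite: Balaban1988Convergent, (3.39) p.274] -/
theorem E0_transport_symm (σ : β ≃ β) (star : Finset β) (hstar : star.map σ.toEmbedding = star)
    {gaussB chiB vB gaussB' chiB' vB' : β → ℝ} (g : ℝ) (hg : ∀ b, gaussB' (σ b) = gaussB b)
    (hc : ∀ b, chiB' (σ b) = chiB b) (hv : ∀ b, vB' (σ b) = vB b) (b : β) :
    E0 star gaussB' chiB' g vB' b = E0 star gaussB chiB g vB (σ.symm b) := by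
  have := E0_transport σ star hstar g hg hc hv (σ.symm b)
  rwa [Equiv.apply_symm_apply] at this

end Assembly

section Site

variable {d : ℕ} {Z : Type*} {X : Type*} [Fintype X]

/-- **Covariance of the per-site terms (3.41)** (*"This function has the same properties as the function (3.37) …
Euclidean covariant"*): for a symmetry acting on coarse sites by `ρ`, on fine sites by `ρX` and on directions by `δ`,
compatible with the backward translations (`ρ (z − Le_μ) = ρ z − Le_{δμ}`), under which the coarse-bond factors
`log z^{(k)}`, the tent weights `h_z(x)` ((3.40)) and the per-bond terms (3.37) transform covariantly, the per-site term
built from the transformed data at `ρ z` equals the original at `z`.  (Symmetries mapping forward bonds to forward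
bonds; a reflection exchanges the two half-bond terms of (3.41) — not typed.) [cite: Balaban1988Convergent, (3.41) p.275] -/
theorem E0site_transport (ρ : Z ≃ Z) (ρX : X ≃ X) (δ : Fin d ≃ Fin d) {back : Fin d → Z → Z}
    (hback : ∀ μ z, ρ (back μ z) = back (δ μ) (ρ z))
    {logz logz' : Z × Fin d → ℝ} (hlogz : ∀ z μ, logz' (ρ z, δ μ) = logz (z, μ))
    {h h' : Z → X → ℝ} (hh : ∀ z x, h' (ρ z) (ρX x) = h z x)
    {E0b E0b' : X × Fin d → ℝ} (hE : ∀ x μ, E0b' (ρX x, δ μ) = E0b (x, μ)) (z : Z) :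
    E0site logz' h' E0b' back (ρ z) = E0site logz h E0b back z := by
  unfold E0site
  rw [← Equiv.sum_comp δ (fun μ => (1/2 : ℝ) * (logz' (back μ (ρ z), μ) + logz' (ρ z, μ))
    + ∑ x, h' (ρ z) x * E0b' (x, μ))]
  refine Finset.sum_congr rfl fun μ _ => ?_
  rw [← hback, hlogz, hlogz, ← Equiv.sum_comp ρX (fun x => h' (ρ z) x * E0b' (x, δ μ))]
  simp only [hh, hE]

end Site

end Literature.MathematicalPhysics.QuantumFieldTheory.Balaban1983to89.B14.Eq339Covariance
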